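import Summits.CriticalPhenomena.Ising3DConformalLimit.Theses.LinkingParityCircles
import Summits.CriticalPhenomena.Ising3DConformalLimit.Theorems.MoebiusLimitExists.Negative.FreeTranslations
import HarnessLib

/-!
# Crux `LinkingParityCircles.SpinRatioMoebius` (stmt-CriticalPhenomena-4530), line `registered` —
# stub `stub_cellLimitTranslate`: translation invariance of mesh limits is FREE

Generalisation of `MoebiusLimitExistsNegative.limit_translate` (which is stated for the rescaled
critical correlators `ρ(δ)ⁿ ⟨∏σ_{[xᵢ/δ]}⟩`) to an ARBITRARY family `F δ : ((ℝ³)ⁿ → ℝ)` of mesh-`δ`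
lattice functionals that is invariant under moving every point by the same lattice vector
`δ • k`, `k ∈ ℤ³` (e.g. the weight-free spin pairing ratios of the crux, where the renormalisation
cancels and no `LatticeCorrFamily` is available): any locally uniform limit `g` of `F δ` as `δ → 0⁺`
on the non-coincident configurations is invariant under EVERY real translation there.

Mechanism (verbatim the tree's): along the meshes `δ_k = t/(k+1)` the translation by `t·m̂`
(`m ∈ ℤ³`, `t > 0`) is the lattice translation by `(k+1)m` at mesh `δ_k`, so `F δ_k (x + t m̂) = F δ_k x`
exactly, limits along `𝓝[>] 0` restrict to that sequence, and a general `v ∈ ℝ³` is the composite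
of three axis translations.

References: S. Friedli, Y. Velenik, *Statistical Mechanics of Lattice Systems* (CUP 2017), Thm. 3.17
(translation invariance of `⟨·⟩⁺`), the only model input, entering through the hypothesis.
-/

noncomputable section

namespace Summit.CriticalPhenomena.Ising3DConformalLimit.Cruxes.SpinRatioMoebius.Birth

open Literature.Probability.LatticeModels Filter Set
open Summit.CriticalPhenomena.Ising3DConformalLimit.MoebiusLimitExistsNegative
open scoped Topology

/-- `t • m̂ = δ_k • ((k+1) m)^` with `δ_k = t/(k+1)`: a real multiple of a lattice vector is, at
mesh `t/(k+1)`, the mesh multiple of a lattice vector. [folklore] -/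
theorem smul_siteVec_eq_mesh_smul (t : ℝ) (m : Site 3) (k : ℕ) :
    t • siteVec m = (t / ((k : ℝ) + 1)) • siteVec ((((k + 1 : ℕ) : ℤ)) • m) := by
  ext j
  have hk : ((k : ℝ) + 1) ≠ 0 := by positivity
  have h1 : ((((((k + 1 : ℕ) : ℤ)) • m) j : ℤ) : ℝ) = ((k : ℝ) + 1) * (m j : ℝ) := by
    rw [Pi.smul_apply, smul_eq_mul]
    push_cast
    ring
  simp only [PiLp.smul_apply, siteVec_apply, smul_eq_mul]
  rw [h1]
  field_simp

/-- Translation by `t·m̂`, `t > 0`, `m ∈ ℤ³`, of a locally uniform mesh limit of a lattice-shift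
invariant family. [folklore] -/
theorem cellLimit_translate_pos {n : ℕ} {F : ℝ → (Fin n → EuclideanSpace ℝ (Fin 3)) → ℝ}
    {g : (Fin n → EuclideanSpace ℝ (Fin 3)) → ℝ}
    (hshift : ∀ δ : ℝ, 0 < δ → ∀ (x : Fin n → EuclideanSpace ℝ (Fin 3)) (k : Site 3),
      F δ (fun i => x i + δ • siteVec k) = F δ x)
    (hlim : TendstoLocallyUniformlyOn F g (𝓝[>] 0) (NonCoincident 3 n))
    {x : Fin n → EuclideanSpace ℝ (Fin 3)} (hx : x ∈ NonCoincident 3 n) (m : Site 3) {t : ℝ}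
    (ht : 0 < t) :
    g (fun i => x i + t • siteVec m) = g x := by
  have hxv : (fun i => x i + t • siteVec m) ∈ NonCoincident 3 n := (add_mem_nonCoincident_iff _ x).2 hx
  have h1 := (hlim.tendsto_at hxv).comp (tendsto_div_succ_nhdsGT ht)
  have h2 := (hlim.tendsto_at hx).comp (tendsto_div_succ_nhdsGT ht)
  refine tendsto_nhds_unique h1 (h2.congr fun k => ?_)
  simp only [Function.comp_apply]
  have hδ : 0 < t / ((k : ℝ) + 1) := by positivity
  have hcfg : (fun i => x i + t • siteVec m) =
      fun i => x i + (t / ((k : ℝ) + 1)) • siteVec ((((k + 1 : ℕ) : ℤ)) • m) := by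
    funext i
    rw [smul_siteVec_eq_mesh_smul t m k]
  rw [hcfg]
  exact (hshift _ hδ x _).symm

/-- Translation by any real multiple of a lattice vector. [folklore] -/
theorem cellLimit_translate_smul_siteVec {n : ℕ} {F : ℝ → (Fin n → EuclideanSpace ℝ (Fin 3)) → ℝ}
    {g : (Fin n → EuclideanSpace ℝ (Fin 3)) → ℝ}
    (hshift : ∀ δ : ℝ, 0 < δ → ∀ (x : Fin n → EuclideanSpace ℝ (Fin 3)) (k : Site 3),
      F δ (fun i => x i + δ • siteVec k) = F δ x)
    (hlim : TendstoLocallyUniformlyOn F g (𝓝[>] 0) (NonCoincident 3 n))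
    {x : Fin n → EuclideanSpace ℝ (Fin 3)} (hx : x ∈ NonCoincident 3 n) (m : Site 3) (t : ℝ) :
    g (fun i => x i + t • siteVec m) = g x := by
  rcases lt_trichotomy t 0 with ht | rfl | ht
  · have h : t • siteVec m = (-t) • siteVec (-m) := by
      ext j; simp [siteVec_apply]
    rw [h]
    exact cellLimit_translate_pos hshift hlim hx (-m) (by linarith)
  · simp
  · exact cellLimit_translate_pos hshift hlim hx m ht

/-- **Stub `stub_cellLimitTranslate` (translation invariance of mesh limits is free).** For every
family `F δ` of functionals of `n`-point configurations in `ℝ³` that is invariant under the common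
lattice translations `xᵢ ↦ xᵢ + δ•k` (`k ∈ ℤ³`) at every mesh `δ > 0`, every locally uniform limit
`g` of `F δ` (`δ → 0⁺`) on `NonCoincident 3 n` satisfies `g (x + v) = g x` for all `v ∈ ℝ³` and all
non-coincident `x`. [cite: FriedliVelenik2017, Thm. 3.17] -/
theorem stub_cellLimitTranslate :
    ∀ (n : ℕ) (F : ℝ → (Fin n → EuclideanSpace ℝ (Fin 3)) → ℝ) (g : (Fin n → EuclideanSpace ℝ (Fin 3)) → ℝ), (∀ δ : ℝ, 0 < δ → ∀ (x : Fin n → EuclideanSpace ℝ (Fin 3)) (k : Literature.Probability.LatticeModels.Site 3), F δ (fun i => x i + δ • Literature.Probability.LatticeModels.siteVec k) = F δ x) → TendstoLocallyUniformlyOn F g (nhdsWithin 0 (Set.Ioi 0)) (Literature.Probability.LatticeModels.NonCoincident 3 n) → ∀ (v : EuclideanSpace ℝ (Fin 3)), ∀ x ∈ Literature.Probability.LatticeModels.NonCoincident 3 n, g (fun i => x i + v) = g x := by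
  intro n F g hshift hlim v x hx
  set a : EuclideanSpace ℝ (Fin 3) := v 0 • siteVec (Pi.single 0 1 : Site 3) with ha
  set b : EuclideanSpace ℝ (Fin 3) := v 1 • siteVec (Pi.single 1 1 : Site 3) with hb
  set c : EuclideanSpace ℝ (Fin 3) := v 2 • siteVec (Pi.single 2 1 : Site 3) with hc
  have hv : v = a + b + c := by
    ext j
    fin_cases j <;> simp [ha, hb, hc, siteVec_apply]
  have hxa : (fun i => x i + a) ∈ NonCoincident 3 n := (add_mem_nonCoincident_iff _ _).2 hx
  have hxab : (fun i => (x i + a) + b) ∈ NonCoincident 3 n := (add_mem_nonCoincident_iff _ _).2 hxa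
  have hcfg : (fun i => x i + v) = fun i => ((x i + a) + b) + c := by
    funext i; rw [hv]; abel
  rw [hcfg, cellLimit_translate_smul_siteVec hshift hlim hxab _ _,
    cellLimit_translate_smul_siteVec hshift hlim hxa _ _, cellLimit_translate_smul_siteVec hshift hlim hx _ _]

end Summit.CriticalPhenomena.Ising3DConformalLimit.Cruxes.SpinRatioMoebius.Birth

end
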